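import Summits.BirchSwinnertonDyer.BirchSwinnertonDyer.Theorems.SignedLowerHalvesKobayashiMainConjectureSmallImageShadowInert
import Literature.NumberTheory.EllipticCurves.SupersingularInertiaShapeProofs
import Literature.NumberTheory.DiophantineGeometry.GeneralizedFermatTwoPowerCoefficientSerreWeightProofs
import Literature.NumberTheory.EllipticCurves.IsogenyFrobeniusTraceProofs
import Literature.NumberTheory.GaloisRepresentations.DecompositionGroupOfCompletion
import HarnessLib

/-!
# ORIENTATION (Galois form): the inertia Cartan field `k` of `E[p]` embeds in `k̄` so that
# `Φ(ρ̄(σ)) ↦ ψ₂(σ)` on the inertia group of `ℚ_p` (Serre 1972 §1.11 Prop. 12 b) as a character)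

Route `SignedLowerHalves`, child L `SmallImageLowerHalfBothSigns` (item stmt-BirchSwinnertonDyer-23599), line
proposal `rtt_w3`, stub K0₂@p `stub_heckeThetaPartner_ns` — brick AH5 "ORIENT-G" of the arithmetic half at an
ODD prime (width seat `bsd-line-slh-p3-w3` gen 9; memo `Lines/birth_acns-MEMO-w3-g9.md`).  THEOREMS ONLY
(no definition, no named fact, no `sorry`); ROUTE-INDEPENDENT.

At a good supersingular `p ≠ 2` of `E = W/ℚ` the inertia image on `E[p]` in a frame `Φ` IS a non-split
Cartan subgroup `kˣ` (`GaloisImage.exists_unitGroup_eq_inertia_image_of_goodSS`), as a SUBGROUP.  The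
CM-partner construction at odd `p` needs the finer, character-level statement (Serre 1972 §1.11 Prop. 12 b):
"il existe sur `E_p` une structure de `𝔽_{p²}`-espace vectoriel de dimension `1` telle que l'action de `I_t`
soit donnée par le caractère fondamental `θ_{p²−1}` de niveau `2`"): there is a ring embedding `j : k → k̄`
under which the inertia element `Φ(ρ̄(res σ)) ∈ kˣ` goes to the value `ψ₂(σ)` of THE level-two
fundamental character (and not to `ψ₂(σ)^m` for some other unit `m mod p²−1` — at `p = 3` the exponents
`m ∈ {5, 7}` would be `ρ̄ ⊗ ω⁻¹`, Serre weight `6`, which has no weight-two CM lift of level prime to `p`).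

* `exists_ringHom_apply_eq_fundamentalCharacter` — for `W/ℚ` globally minimal, `p ≠ 2`, `GoodSS W p`, a
  frame `(e, Φ)` of `E[p]`, a field `k ⊆ M₂(𝔽_p)` of degree `2` with `Φ(ρ̄(Γ_ℚ)) ≤ N(kˣ)`, the place
  `v ∋ p`, and a residue embedding `ι` into a field `k'`: **there is `j : k →+* k'` with
  `j(Φ(ρ̄(res σ))) = ψ₂(σ)` for every `σ` in the inertia group of `ℚ_v`** (`res = absGaloisRestrict ℚ ℚ_v`,
  `ψ₂ = fundamentalCharacter ℚ_v 2 ι p`; the membership `Φ(ρ̄(res σ)) ∈ k` is part of the conclusion).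
  Proof: Serre's additive injective `ψ₂`-equivariant `θ : E[p] → k'`
  (`WeierstrassCurve.exists_additive_equivariant_of_dvd_frobeniusTraceAt`) makes `E[p]` a `k'`-line on which
  `ρ̄(res σ)` is multiplication by `ψ₂(σ)`; every `y ∈ k` acts on `E[p]` (through `e`) by a `k'`-scalar
  `j(y)` (`kˣ` IS the inertia image: `exists_unitGroup_eq_inertia_image_of_goodSS`, Prop. 14
  `prop14_unitGroup`, `map_inertia_adicCompletionPrime`), and `y ↦ j(y)` is a ring homomorphism.
* `apply_res_mem_unitGroup_of_mem_absInertia` — the membership clause alone.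

This is the Galois-side half of the orientation input (O) of the memo; the CFT half (the local component
at `p` of the Hecke character of `χ̄` is `u ↦ Teich(ū)⁻¹`, via `coe_lubinTateChar_toAbsGalois` and
`artinCharacter_localGlobalCompatible`) is brick ORIENT-CFT.  BSD, crux L and the stub are NOT proved here.

References: J.-P. Serre, Invent. Math. 15 (1972) §1.7 Prop. 3, §1.10 Prop. 10, §1.11 Prop. 12, §2.2 Prop. 14.
-/

set_option autoImplicit false
set_option linter.dupNamespace false

noncomputable section

open scoped Classical NumberField MatrixGroups
open IsDedekindDomain Field Matrix NumberField WeierstrassCurve Literature.NumberTheory.EllipticCurves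
  Literature.NumberTheory.GaloisRepresentations Rat.HeightOneSpectrum
  Literature.NumberTheory.EllipticCurves.Rank1Residual Summit.BirchSwinnertonDyer.Rank1Residual
  Literature.NumberTheory.GaloisRepresentations.IsNonarchimedeanLocalField
  Literature.NumberTheory.GaloisRepresentations.ModPGaloisRep ValuativeRel
  Literature.NumberTheory.DiophantineGeometry

namespace Summit.BirchSwinnertonDyer.BirchSwinnertonDyer.Theorems.SmallImageLambdaLowerThreeNsThetaPartner

variable (W : WeierstrassCurve ℚ) [W.IsElliptic] [W.IsGloballyMinimal] (p : ℕ) [Fact p.Prime]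
  (Φ : Multiplicative (AddAut (geomTorsion W p)) ≃* GL (Fin 2) (ZMod p))

/-- **The local inertia image is the Cartan subgroup `kˣ`.**  At a good supersingular `p ≠ 2`, for a frame
`Φ` and a field `k ⊆ M₂(𝔽_p)` of degree `2` with `Φ(ρ̄(Γ_ℚ)) ≤ N(kˣ)`, and the place `v ∋ p`:
`kˣ = Φ(ρ̄(res(I_{ℚ_v})))` (inertia image at the prime `𝔓₀` of `\bar ℤ` cut out by the completion
= a non-split Cartan subgroup, = `kˣ` by Prop. 14). [cite: Serre1972, §1.11 Prop. 12 c), §2.2 Prop. 14] -/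
theorem unitGroup_eq_map_absInertia (hp2 : p ≠ 2) (hss : GoodSS W p)
    {k : Subalgebra (ZMod p) (Matrix (Fin 2) (Fin 2) (ZMod p))} (hk : IsField k)
    (h2 : Module.finrank (ZMod p) k = 2)
    (hGN : (galoisRepTorsion W p).range.map Φ.toMonoidHom ≤
      Subgroup.normalizer (Serre1972.unitGroup k : Set (GL (Fin 2) (ZMod p))))
    {v : HeightOneSpectrum (𝓞 ℚ)} (hpv : (p : 𝓞 ℚ) ∈ v.asIdeal) :
    Serre1972.unitGroup k =
      (absInertia (v.adicCompletion ℚ)).map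
        ((Φ.toMonoidHom.comp (galoisRepTorsion W p)).comp
          (absGaloisRestrict ℚ (v.adicCompletion ℚ)).toMonoidHom) := by
  have hpP : p.Prime := Fact.out
  have hp3 : 3 ≤ p := by have := hpP.two_le; omega
  have hv' : (primesEquiv v : ℕ) = p := primesEquiv_eq_of_natCast_mem hpP hpv
  have h𝔔 := adicCompletionPrime_mem_primesAbove ℚ v
  obtain ⟨k', hk', h2', hk'I⟩ :=
    GaloisImage.exists_unitGroup_eq_inertia_image_of_goodSS W p Φ hp2 hss hv' h𝔔
  have hC : Serre1972.unitGroup k ∈ Serre1972.cartanSubgroups (ZMod p) :=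
    Serre1972.unitGroup_mem_cartanSubgroups hk h2
  have hHle : (((adicCompletionPrime ℚ v).inertia (absoluteGaloisGroup ℚ)).map
      (galoisRepTorsion W p)).map Φ.toMonoidHom ≤ (galoisRepTorsion W p).range.map Φ.toMonoidHom :=
    Subgroup.map_mono (fun x ⟨τ, _, hτ⟩ ↦ ⟨τ, hτ⟩)
  have hk'N : Serre1972.unitGroup k' ≤
      Subgroup.normalizer (Serre1972.unitGroup k : Set (GL (Fin 2) (ZMod p))) := by
    rw [← hk'I]; exact hHle.trans hGN
  have hkk : Serre1972.unitGroup k' = Serre1972.unitGroup k :=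
    Serre1972.prop14_unitGroup hC hp3 hk' h2' hk'N
  rw [← hkk, ← hk'I, Subgroup.map_map, map_inertia_adicCompletionPrime]

/-- For `σ` in the inertia group of `ℚ_v` (`v ∋ p`), `Φ(ρ̄(res σ)) ∈ kˣ`. [cite: Serre1972, §1.11 Prop. 12 c)] -/
theorem apply_res_mem_unitGroup_of_mem_absInertia (hp2 : p ≠ 2) (hss : GoodSS W p)
    {k : Subalgebra (ZMod p) (Matrix (Fin 2) (Fin 2) (ZMod p))} (hk : IsField k)
    (h2 : Module.finrank (ZMod p) k = 2)
    (hGN : (galoisRepTorsion W p).range.map Φ.toMonoidHom ≤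
      Subgroup.normalizer (Serre1972.unitGroup k : Set (GL (Fin 2) (ZMod p))))
    {v : HeightOneSpectrum (𝓞 ℚ)} (hpv : (p : 𝓞 ℚ) ∈ v.asIdeal)
    (σ : absInertia (v.adicCompletion ℚ)) :
    Φ (galoisRepTorsion W p (absGaloisRestrict ℚ (v.adicCompletion ℚ)
        (σ : absoluteGaloisGroup (v.adicCompletion ℚ)))) ∈ Serre1972.unitGroup k := by
  rw [unitGroup_eq_map_absInertia W p Φ hp2 hss hk h2 hGN hpv]
  exact ⟨σ, σ.2, rfl⟩

set_option maxHeartbeats 400000 in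
/-- **ORIENT-G (Serre 1972 §1.11 Prop. 12 b) as a character, in a frame).**  `W/ℚ` globally minimal,
`p ≠ 2`, `GoodSS W p`, a frame `(e, Φ)` of `E[p]`, a field `k ⊆ M₂(𝔽_p)` of degree `2` with
`Φ(ρ̄(Γ_ℚ)) ≤ N(kˣ)`, the place `v ∋ p`, `p` as uniformiser of `ℚ_v` (`hirr`) and a residue embedding `ι`
into a field `k'`.  Then there is a ring homomorphism `j : k →+* k'` such that for every `σ` in the
inertia group of `ℚ_v`, `Φ(ρ̄(res σ)) ∈ k` and `j(Φ(ρ̄(res σ))) = ψ₂(σ)`, `ψ₂` the fundamental character of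
level `2` of `ℚ_v` (w.r.t. `ι` and the uniformiser `p`).  See the module docstring for the proof.
[cite: Serre1972, §1.11 Prop. 12 b), §1.10 Prop. 10, §1.7 Prop. 3] -/
theorem exists_ringHom_apply_eq_fundamentalCharacter (hp2 : p ≠ 2) (hss : GoodSS W p)
    (e : geomTorsion W p ≃+ (Fin 2 → ZMod p))
    (he : ∀ (g : Multiplicative (AddAut (geomTorsion W p))) (x : geomTorsion W p),
      e (Multiplicative.toAdd g x) = ((Φ g : GL (Fin 2) (ZMod p)) : Matrix (Fin 2) (Fin 2) (ZMod p)) *ᵥ e x)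
    {k : Subalgebra (ZMod p) (Matrix (Fin 2) (Fin 2) (ZMod p))} (hk : IsField k)
    (h2 : Module.finrank (ZMod p) k = 2)
    (hGN : (galoisRepTorsion W p).range.map Φ.toMonoidHom ≤
      Subgroup.normalizer (Serre1972.unitGroup k : Set (GL (Fin 2) (ZMod p))))
    {v : HeightOneSpectrum (𝓞 ℚ)} (hpv : (p : 𝓞 ℚ) ∈ v.asIdeal)
    {k' : Type} [Field k'] (hirr : Irreducible ((p : ℕ) : 𝒪[v.adicCompletion ℚ]))
    (ι : absIntegers 𝒪[v.adicCompletion ℚ] (v.adicCompletion ℚ) ⧸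
      absMaximalIdeal (v.adicCompletion ℚ) →+* k') :
    ∃ j : k →+* k', ∀ σ : absInertia (v.adicCompletion ℚ),
      ∃ hσ : ((Φ (galoisRepTorsion W p (absGaloisRestrict ℚ (v.adicCompletion ℚ)
          (σ : absoluteGaloisGroup (v.adicCompletion ℚ)))) : GL (Fin 2) (ZMod p)) :
            Matrix (Fin 2) (Fin 2) (ZMod p)) ∈ k,
        j ⟨_, hσ⟩ = (fundamentalCharacter (v.adicCompletion ℚ) 2 ι ((p : ℕ) : 𝒪[v.adicCompletion ℚ]) hirr σ : k') := by
  have hpP : p.Prime := Fact.out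
  have hv' : (primesEquiv v : ℕ) = p := primesEquiv_eq_of_natCast_mem hpP hpv
  -- the local datum at `v`
  have hq : residueFieldCard (v.adicCompletion ℚ) = p := residueFieldCard_adicCompletion_eq_of_natCast_mem hpv
  have hgen := natCast_dvd_of_mem_maximalIdeal_adicCompletionIntegers (v := v) hpv
  have hgood : W.HasGoodReductionAt v := (hasGoodReductionAtPrime_primesEquiv_iff_holds W v p hv').mp hss.1
  have hssv : (p : ℤ) ∣ W.frobeniusTraceAt v := by
    rw [W.frobeniusTraceAt_eq_frobeniusTrace v, hv']; exact hss.2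
  -- Serre's additive `ψ₂`-equivariant embedding
  obtain ⟨θ, hθadd, hθinj, hθsmul⟩ :=
    W.exists_additive_equivariant_of_dvd_frobeniusTraceAt p hp2 v hpv hgood hssv hgen hirr hq ι
  set res := absGaloisRestrict ℚ (v.adicCompletion ℚ) with hres
  set ψ := fundamentalCharacter (v.adicCompletion ℚ) 2 ι ((p : ℕ) : 𝒪[v.adicCompletion ℚ]) hirr with hψ
  -- the action of `y ∈ M₂(𝔽_p)` on `E[p]` through the frame `e`
  let A : Matrix (Fin 2) (Fin 2) (ZMod p) → geomTorsion W p → geomTorsion W p :=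
    fun y X ↦ e.symm (y *ᵥ e X)
  have hA : ∀ y X, e (A y X) = y *ᵥ e X := fun y X ↦ e.apply_symm_apply _
  have hAgal : ∀ (τ : absoluteGaloisGroup ℚ) (X : geomTorsion W p),
      A ((Φ (galoisRepTorsion W p τ) : GL (Fin 2) (ZMod p)) : Matrix (Fin 2) (Fin 2) (ZMod p)) X =
        Multiplicative.toAdd (galoisRepTorsion W p τ) X := by
    intro τ X
    apply e.injective
    rw [hA, he]
  have hAadd : ∀ y y' X, A (y + y') X = A y X + A y' X := by
    intro y y' X; apply e.injective; rw [hA, map_add, hA, hA, Matrix.add_mulVec]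
  have hAmul : ∀ y y' X, A (y * y') X = A y (A y' X) := by
    intro y y' X; apply e.injective; rw [hA, hA, hA, Matrix.mulVec_mulVec]
  have hAone : ∀ X, A 1 X = X := by
    intro X; apply e.injective; rw [hA, Matrix.one_mulVec]
  have hAzero : ∀ X, A 0 X = 0 := by
    intro X; apply e.injective; rw [hA, Matrix.zero_mulVec, map_zero]
  -- `θ` on the subtype `E[p]`
  let Θ : geomTorsion W p → k' := fun X ↦ θ (X : geomPoints W)
  have hΘadd : ∀ X Y : geomTorsion W p, Θ (X + Y) = Θ X + Θ Y :=
    fun X Y ↦ hθadd X X.2 Y Y.2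
  have hΘzero : Θ 0 = 0 := by
    have h := hΘadd 0 0
    rw [add_zero] at h
    exact left_eq_add.mp h
  have hΘinj : ∀ X : geomTorsion W p, Θ X = 0 → X = 0 :=
    fun X hX ↦ Subtype.ext (hθinj X X.2 hX)
  have hΘsmul : ∀ (σ : absInertia (v.adicCompletion ℚ)) (X : geomTorsion W p),
      Θ (Multiplicative.toAdd (galoisRepTorsion W p (res (σ : absoluteGaloisGroup (v.adicCompletion ℚ)))) X) =
        (ψ σ : k') * Θ X := by
    intro σ X
    have h := hθsmul σ X X.2
    simpa only [Θ, galoisRepTorsion_apply, AddSubgroup.torsionBy.coe_smul] using h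
  -- a non-zero torsion point, with `Θ X₀ ≠ 0`
  obtain ⟨X₀, hX₀⟩ : ∃ X₀ : geomTorsion W p, Θ X₀ ≠ 0 := by
    refine ⟨e.symm (fun _ ↦ 1), fun h ↦ ?_⟩
    have h1 := congrArg e (hΘinj _ h)
    rw [e.apply_symm_apply, map_zero] at h1
    exact one_ne_zero (congrFun h1 0)
  -- uniqueness of the scalar through which `y` acts
  have huniq : ∀ (y : Matrix (Fin 2) (Fin 2) (ZMod p)) (c c' : k'),
      (∀ X, Θ (A y X) = c * Θ X) → (∀ X, Θ (A y X) = c' * Θ X) → c = c' := by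
    intro y c c' hc hc'
    have h := (hc X₀).symm.trans (hc' X₀)
    exact mul_right_cancel₀ hX₀ h
  -- existence: `kˣ` is the inertia image
  have hU := unitGroup_eq_map_absInertia W p Φ hp2 hss hk h2 hGN hpv
  have hexists : ∀ y ∈ k, ∃ c : k', ∀ X, Θ (A y X) = c * Θ X := by
    intro y hy
    by_cases hy0 : y = 0
    · refine ⟨0, fun X ↦ ?_⟩
      rw [hy0, hAzero, zero_mul]; exact hΘzero
    · have hdet : y.det ≠ 0 := Serre1972.det_ne_zero_of_isField hk hy hy0
      set Y : GL (Fin 2) (ZMod p) := Matrix.GeneralLinearGroup.mkOfDetNeZero y hdet with hYdef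
      have hY : Y ∈ Serre1972.unitGroup k := by
        rw [Serre1972.mem_unitGroup_iff]; exact hy
      rw [hU] at hY
      obtain ⟨σ, hσI, hσ⟩ := hY
      refine ⟨(ψ ⟨σ, hσI⟩ : k'), fun X ↦ ?_⟩
      have hyσ : y = ((Φ (galoisRepTorsion W p (res σ)) : GL (Fin 2) (ZMod p)) :
          Matrix (Fin 2) (Fin 2) (ZMod p)) := by
        have := congrArg (fun g : GL (Fin 2) (ZMod p) ↦ (g : Matrix (Fin 2) (Fin 2) (ZMod p))) hσ
        simpa [hYdef] using this.symm
      rw [hyσ, hAgal]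
      exact hΘsmul ⟨σ, hσI⟩ X
  -- the ring homomorphism `j`
  choose c hc using hexists
  let j₀ : k → k' := fun y ↦ c y.1 y.2
  have hj₀ : ∀ (y : k) X, Θ (A (y : Matrix (Fin 2) (Fin 2) (ZMod p)) X) = j₀ y * Θ X :=
    fun y X ↦ hc y.1 y.2 X
  have hj₀_one : j₀ 1 = 1 :=
    huniq 1 _ _ (hj₀ 1) (fun X ↦ by rw [hAone, one_mul])
  have hj₀_mul : ∀ y y' : k, j₀ (y * y') = j₀ y * j₀ y' := fun y y' ↦
    huniq _ _ _ (hj₀ (y * y')) (fun X ↦ by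
      rw [Subalgebra.coe_mul, hAmul, hj₀ y, hj₀ y', mul_assoc])
  have hj₀_zero : j₀ 0 = 0 :=
    huniq _ _ _ (hj₀ 0) (fun X ↦ by
      have h0 : A ((0 : k) : Matrix (Fin 2) (Fin 2) (ZMod p)) X = 0 := hAzero X
      rw [h0, zero_mul]; exact hΘzero)
  have hj₀_add : ∀ y y' : k, j₀ (y + y') = j₀ y + j₀ y' := fun y y' ↦
    huniq _ _ _ (hj₀ (y + y')) (fun X ↦ by
      rw [Subalgebra.coe_add, hAadd, hΘadd, hj₀ y, hj₀ y', add_mul])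
  let j : k →+* k' :=
    { toFun := j₀, map_one' := hj₀_one, map_mul' := hj₀_mul, map_zero' := hj₀_zero, map_add' := hj₀_add }
  refine ⟨j, fun σ ↦ ?_⟩
  have hσ := apply_res_mem_unitGroup_of_mem_absInertia W p Φ hp2 hss hk h2 hGN hpv σ
  rw [Serre1972.mem_unitGroup_iff] at hσ
  refine ⟨hσ, ?_⟩
  change j₀ ⟨_, hσ⟩ = _
  exact huniq _ _ _ (hj₀ ⟨_, hσ⟩) (fun X ↦ by rw [hAgal]; exact hΘsmul σ X)

end Summit.BirchSwinnertonDyer.BirchSwinnertonDyer.Theorems.SmallImageLambdaLowerThreeNsThetaPartner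

end
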